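import Literature.Computability.MetaComplexity.ProofSystems
import Literature.Computability.Complexity.TimeBoundsProofs
import Mathlib.Algebra.Polynomial.Basic
import Mathlib.Algebra.Polynomial.Eval.Defs
import HarnessLib
import Literature.Computability.Complexity.LengthCompare
import Literature.Computability.Complexity.PairingMachines
import Literature.Computability.Complexity.PairProjections
import Literature.Computability.Complexity.StringSwap
import Literature.Computability.Complexity.BranchingFn

/-!
# Proofs: polynomial boundedness transfers up (p-)simulations

Sibling proof file of `ProofSystems.lean` (D-0014: named facts `def X : Prop` are discharged as
`theorem X_holds : X`). It discharges

* `Literature.CplxMeta.PSimulates.simulates_holds : PSimulates.simulates` — a p-simulation is a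
  (weak) simulation: a polynomial-time proof translation has polynomially bounded output;
* `Literature.CplxMeta.IsPolyBounded.of_simulates_holds : IsPolyBounded.of_simulates` — if `V`
  simulates `W` (proof systems for the same language) and `W` is polynomially bounded, so is
  `V`;
* `Literature.CplxMeta.IsPolyBounded.of_pSimulates_holds : IsPolyBounded.of_pSimulates` — the same
  for p-simulation (the two previous results composed);
* `Literature.Computability.MetaComplexity.hasPolyBoundedProofSystem_iff_mem_NP_holds` (Cook–Reckhow 1979, Prop. 1.4) and
  `exists_isProofSystemFor_of_mem_NP_holds`, using the polynomial-time witness-length test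
  `LenLe p ∈ P` (`Complexity/LengthCompare.lean`), closure of `P` under intersection
  (`Complexity/StringCopy.lean`) and the re-pairing machine (`polyTimeComputable_boolUnpair`);
* `PSimulates.refl_holds`, `PEquiv.refl_holds` (identity translation = second projection,
  `polyTimeComputable_snd_holds`, `Complexity/PairProjections.lean`);
* `PSimulates.trans_holds`, `PEquiv.trans_holds` (compose translations; the machine copies the input,
  `Complexity/StringCopy.lean`, and rewrites the second component, `Complexity/StringSwap.lean`);
* `exists_isCookReckhowFunctionFor_iff_holds` (Cook–Reckhow 1979, Def. 1.3 with the proof of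
  Prop. 1.4; Krajíček 2019, Def. 1.5.1 and the paragraph following it): for nonempty `L`, the
  "onto polynomial-time function" form and the verifier form of a proof system are equivalent
  (the graph `V x π := [f π = x]` via the equality test `eqPairFn`,
  `Complexity/StringEquality.lean`; the function `⟨x, π⟩ ↦ if V x π then x else x₀` via the
  branching combinator `iteFn`, `Complexity/BranchingFn.lean`).

## Source and printed argument

Cook–Reckhow, *The relative efficiency of propositional proof systems*, J. Symbolic Logic 44
(1979), §1, remark after the definition of p-simulation; stated as an exercise in
Cook–Nguyen, *Logical Foundations of Proof Complexity* (CUP 2010), p. 211, Exercise VII.1.6 (b):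
"Show that if `F₁` p-simulates `F₂`, and `F₂` is polynomially bounded, then `F₁` is also
polynomially bounded." (Def. VII.1.5 ibid.: `F₁` p-simulates `F₂` if a polytime `G` has
`F₂(X) = F₁(G(X))`.) Krajíček, *The Cook–Reckhow definition* (arXiv:1909.03691), Def. 2.1: a
simulation is a translation `h` with `|h(w)| ≤ |w|^c`; a p-simulation is a p-time simulation.

The argument (one line in print): a `V`-proof of `x` witnesses `x ∈ L`, so `x` has a `W`-proof,
hence one of length `≤ q(|x|)`; translating it gives a `V`-proof of length
`≤ p(|x| + q(|x|))`, a polynomial in `|x|`. For the first result, a machine running `p(n)` steps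
on the input `boolPair x π` (of length `n = 2|x| + 2 + |π|`) writes at most `n + D · p(n)`
output symbols (`Turing.TM2ComputableAux.OutputsWithin.length_le`, `D = machinePushBound`).
Monotonicity of evaluation of `ℕ`-polynomials (proved inline) does the bookkeeping.
-/

namespace Literature.Computability.MetaComplexity

open _root_.Computability Complexity Complexity.Classes Polynomial Turing

variable {L : Language Bool} {U V W : List Bool → List Bool → Bool}

/-- **Discharge of `PSimulates.simulates`**: a p-simulation is a simulation. If the translation
`f` is computed in time `p(n)` on `boolPair x π` (`n = 2|x| + 2 + |π| ≤ 2(|x| + |π|) + 2`), its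
output has length `≤ n + D · p(n)` (`OutputsWithin.length_le`), so the polynomial
`(2X + 2) + D · p(2X + 2)` evaluated at `|x| + |π|` bounds `|f x π|`.
[Cook–Reckhow 1979, §1; Krajíček arXiv:1909.03691, Def. 2.1; Cook–Nguyen 2010, Def. VII.1.5]
[cite: CookReckhow1979, §1 (Def. of p-simulation)] -/
theorem PSimulates.simulates_holds : @PSimulates.simulates V W := by
  intro h
  obtain ⟨f, ⟨p, M, hM⟩, hf⟩ := h
  -- evaluation of an `ℕ`-polynomial is monotone in the argument (cf. `Literature.Computability.Complexity.natPoly_eval_mono`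
  -- in `CircuitLowerBounds.lean`, not imported here to keep the dependency light)
  have hmono : ∀ (r : Polynomial ℕ) {a b : ℕ}, a ≤ b → r.eval a ≤ r.eval b := fun r a b hab => by
    rw [eval_eq_sum_range, eval_eq_sum_range]
    exact Finset.sum_le_sum fun i _ => Nat.mul_le_mul_left _ (Nat.pow_le_pow_left hab i)
  refine ⟨(2 * X + 2) + C (TM2Comp.machinePushBound M.tm) * p.comp (2 * X + 2), ?_⟩
  intro x π hπ
  refine ⟨f x π, ?_, hf x π hπ⟩
  have hlen := (hM (x, π)).length_le
  simp only [Function.uncurry_apply_pair, id_eq, length_boolPair] at hlen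
  have hle : 2 * x.length + 2 + π.length ≤ 2 * (x.length + π.length) + 2 := by omega
  have hp := hmono p hle
  simp only [eval_add, eval_mul, eval_C, eval_X, eval_comp, eval_ofNat]
  calc (f x π).length
      ≤ 2 * x.length + 2 + π.length
          + TM2Comp.machinePushBound M.tm * p.eval (2 * x.length + 2 + π.length) := hlen
    _ ≤ 2 * (x.length + π.length) + 2
          + TM2Comp.machinePushBound M.tm * p.eval (2 * (x.length + π.length) + 2) :=
        Nat.add_le_add hle (Nat.mul_le_mul_left _ hp)

/-- **Discharge of `IsPolyBounded.of_simulates`**: polynomial boundedness transfers up a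
simulation between proof systems for the same language. A `V`-proof of `x` gives `x ∈ L`
(soundness of `V`), hence a `W`-proof (completeness of `W`), hence one of length `≤ q(|x|)`
(`W` polynomially bounded), hence a `V`-proof of length `≤ p(|x| + q(|x|))` (simulation, and
monotonicity of `p`); the bound is the polynomial `p ∘ (X + q)`.
[Cook–Reckhow 1979, §1 (remark after the definition of p-simulation); Cook–Nguyen 2010,
p. 211, Exercise VII.1.6 (b)] [cite: CookReckhow1979, §1 (remark after the definition of p-simulation)] -/
theorem IsPolyBounded.of_simulates_holds : @IsPolyBounded.of_simulates L V W := by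
  intro h hW hV hW'
  obtain ⟨p, hp⟩ := h
  -- evaluation of an `ℕ`-polynomial is monotone in the argument (cf. `Literature.Computability.Complexity.natPoly_eval_mono`
  -- in `CircuitLowerBounds.lean`, not imported here to keep the dependency light)
  have hmono : ∀ (r : Polynomial ℕ) {a b : ℕ}, a ≤ b → r.eval a ≤ r.eval b := fun r a b hab => by
    rw [eval_eq_sum_range, eval_eq_sum_range]
    exact Finset.sum_le_sum fun i _ => Nat.mul_le_mul_left _ (Nat.pow_le_pow_left hab i)
  obtain ⟨q, hq⟩ := hW
  refine ⟨p.comp (X + q), fun x π hπ => ?_⟩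
  have hx : x ∈ L := hV.mem_of_eq_true hπ
  obtain ⟨π₀, hπ₀⟩ := (hW'.mem_iff x).1 hx
  obtain ⟨π₁, hπ₁, hWπ₁⟩ := hq x π₀ hπ₀
  obtain ⟨π₂, hπ₂, hVπ₂⟩ := hp x π₁ hWπ₁
  refine ⟨π₂, ?_, hVπ₂⟩
  simp only [eval_comp, eval_add, eval_X]
  exact hπ₂.trans (hmono p (Nat.add_le_add_left hπ₁ _))

/-- **Discharge of `IsPolyBounded.of_pSimulates`**: polynomial boundedness transfers up a
p-simulation between proof systems for the same language — a p-simulation is a simulation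
(`PSimulates.simulates_holds`), and polynomial boundedness transfers up simulations
(`IsPolyBounded.of_simulates_holds`). "If `F₁` p-simulates `F₂`, and `F₂` is polynomially
bounded, then `F₁` is also polynomially bounded."
[Cook–Reckhow 1979, §1; Cook–Nguyen 2010, p. 211, Exercise VII.1.6 (b)]
[cite: CookReckhow1979, §1 (remark after the definition of p-simulation)] -/
theorem IsPolyBounded.of_pSimulates_holds : @IsPolyBounded.of_pSimulates L V W :=
  fun h hW hV hW' => IsPolyBounded.of_simulates_holds (PSimulates.simulates_holds h) hW hV hW'

/-! ### Cook–Reckhow's Proposition 1.4: polynomially bounded proof systems and `NP` -/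

/-- **Discharge of `hasPolyBoundedProofSystem_iff_mem_NP`** (Cook–Reckhow 1979, Prop. 1.4;
Krajíček 2019, Thm. 1.1.3). (`→`) For a polynomially bounded verifier `V` (bound `p`), the `NP`
witness language is `{w | V (boolUnpair w).1 (boolUnpair w).2}`, in `P` by composing the machine of
`V` after the re-pairing machine (`polyTimeComputable_boolUnpair`); short proofs exist by polynomial
boundedness. (`←`) For `L ∈ NP` with witness language `L' ∈ P` and bound `p`, the verifier
`V x π := [⟨x, π⟩ ∈ LenLe p ⊓ L']` has the length test built in (`LenLe_mem_P`, `inter_mem_P`), is a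
proof system for `L`, and is polynomially bounded with the same `p`. [cite: CookReckhow1979, §1  Prop. 1.4 and its corollary] -/
theorem hasPolyBoundedProofSystem_iff_mem_NP_holds : @hasPolyBoundedProofSystem_iff_mem_NP L := by
  constructor
  · rintro ⟨V, ⟨hV, hVL⟩, p, hp⟩
    -- the witness language
    set L' : Language Bool := {w | Function.uncurry V (boolUnpair w) = true} with hL'
    have hL'P : L' ∈ P := by
      refine mem_P_iff_holds.2 (polyTimeDecidable_iff.2 ?_)
      have hcomp : PolyTimeComputable (id : List Bool → List Bool) encodeBool
          (Function.uncurry V ∘ boolUnpair) :=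
        PolyTimeComputable.comp_holds hV polyTimeComputable_boolUnpair
      have hind : L'.boolIndicator = Function.uncurry V ∘ boolUnpair := by
        funext w
        by_cases hw : Function.uncurry V (boolUnpair w) = true
        · rw [(Set.mem_iff_boolIndicator L' w).1 hw]
          exact hw.symm
        · rw [(Set.notMem_iff_boolIndicator L' w).1 hw]
          simp only [Function.comp_apply]
          cases h : Function.uncurry V (boolUnpair w)
          · rfl
          · exact absurd h hw
      rw [hind]
      exact hcomp
    refine ⟨L', hL'P, p, fun x => ?_⟩
    rw [hVL x]
    have hmem : ∀ π : List Bool, boolPair x π ∈ L' ↔ V x π = true := fun π => by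
      change Function.uncurry V (boolUnpair (boolPair x π)) = true ↔ _
      rw [boolUnpair_boolPair]
      rfl
    constructor
    · rintro ⟨π, hπ⟩
      obtain ⟨π', hlen, hπ'⟩ := hp x π hπ
      exact ⟨π', hlen, (hmem π').2 hπ'⟩
    · rintro ⟨π, -, hπ⟩
      exact ⟨π, (hmem π).1 hπ⟩
  · rintro ⟨L', hL', p, hp⟩
    set W : Language Bool := LenLe p ⊓ L' with hW
    have hWP : W ∈ P := inter_mem_P (LenLe_mem_P p) hL'
    have hmemW : ∀ x π : List Bool, boolPair x π ∈ W ↔ π.length ≤ p.eval x.length ∧ boolPair x π ∈ L' :=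
      fun x π => by
        change boolPair x π ∈ LenLe p ∧ boolPair x π ∈ L' ↔ _
        rw [boolPair_mem_LenLe]
    -- the verifier with the length test built in
    let V : List Bool → List Bool → Bool := fun x π => W.boolIndicator (boolPair x π)
    have hVtrue : ∀ x π, V x π = true ↔ boolPair x π ∈ W := fun x π =>
      (Set.mem_iff_boolIndicator W (boolPair x π)).symm
    obtain ⟨q, M, hM⟩ := polyTimeDecidable_iff.1 (mem_P_iff_holds.1 hWP)
    refine ⟨V, ⟨⟨q, M, fun pr => hM (boolPair pr.1 pr.2)⟩, fun x => ?_⟩, p, fun x π hπ => ?_⟩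
    · rw [hp x]
      constructor
      · rintro ⟨π, hlen, hπ⟩
        exact ⟨π, (hVtrue x π).2 ((hmemW x π).2 ⟨hlen, hπ⟩)⟩
      · rintro ⟨π, hπ⟩
        have h := (hmemW x π).1 ((hVtrue x π).1 hπ)
        exact ⟨π, h.1, h.2⟩
    · exact ⟨π, ((hmemW x π).1 ((hVtrue x π).1 hπ)).1, hπ⟩

/-- **Discharge of `exists_isProofSystemFor_of_mem_NP`**: every `NP` language has a (polynomially
bounded) proof system. [cite: CookReckhow1979, §1  Prop. 1.4] -/
theorem exists_isProofSystemFor_of_mem_NP_holds : @exists_isProofSystemFor_of_mem_NP L := by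
  intro hL
  obtain ⟨V, hV, -⟩ := hasPolyBoundedProofSystem_iff_mem_NP_holds.2 hL
  exact ⟨V, hV⟩

/-- **Discharge of `PSimulates.refl`**: translate proofs by the identity, i.e. the second projection
of the pair-coded input (`polyTimeComputable_snd_holds`, `PairProjections.lean`).
[cite: CookReckhow1979, §1] -/
theorem PSimulates.refl_holds : PSimulates.refl := fun _ =>
  ⟨fun _ π => π, polyTimeComputable_snd_holds, fun _ _ h => h⟩

/-- **Discharge of `PEquiv.refl`**. [cite: CookReckhow1979, §1] -/
theorem PEquiv.refl_holds : PEquiv.refl := fun V =>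
  ⟨PSimulates.refl_holds V, PSimulates.refl_holds V⟩

/-! ### Transitivity of p-simulation -/

/-- A pair-coded polynomial-time translation, read as a string function after the total decoder
`boolUnpair`, is in `FP` (`polyTimeComputable_boolUnpair`, `PairingMachines.lean`). [cite: CookReckhow1979, §1] -/
theorem uncurry_comp_boolUnpair_mem_FP {f : List Bool → List Bool → List Bool}
    (hf : PolyTimeComputable (fun p : List Bool × List Bool => boolPair p.1 p.2) id
      (Function.uncurry f)) :
    (Function.uncurry f ∘ boolUnpair) ∈ FP :=
  PolyTimeComputable.comp_holds hf polyTimeComputable_boolUnpair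

/-- **Discharge of `PSimulates.trans`**: compose the translations, `h x π = f x (g x π)`. The
machine: copy the input `⟨x, π⟩` (`copyFn`), project the first copy to `x` (`mapFstFn`), translate the
second copy by `g` (`mapSndFn`, `StringSwap.lean`), then run `f` on `⟨x, g x π⟩`.
[cite: CookReckhow1979, §1] -/
theorem PSimulates.trans_holds : @PSimulates.trans U V W := by
  rintro ⟨f, hf, hfV⟩ ⟨g, hg, hgW⟩
  -- the composite string function
  set F : List Bool → List Bool := Function.uncurry f ∘ boolUnpair with hF
  set G : List Bool → List Bool := Function.uncurry g ∘ boolUnpair with hG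
  set H : List Bool → List Bool :=
    F ∘ mapSndFn G ∘ mapFstFn (fun z => (boolUnpair z).1) ∘ copyFn with hH
  have hHFP : H ∈ FP :=
    comp_mem_FP (uncurry_comp_boolUnpair_mem_FP hf)
      (comp_mem_FP (mapSndFn_mem_FP (uncurry_comp_boolUnpair_mem_FP hg))
        (comp_mem_FP (mapFstFn_mem_FP boolUnpairFst_mem_FP) copyFn_mem_FP))
  have hHval : ∀ x π, H (boolPair x π) = f x (g x π) := fun x π => by
    simp [hH, hF, hG, copyFn_apply, mapFstFn_boolPair, mapSndFn_boolPair]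
  refine ⟨fun x π => f x (g x π), ?_, fun x π hπ => hfV x _ (hgW x π hπ)⟩
  obtain ⟨p, M, hM⟩ := hHFP
  refine ⟨p, M, fun q => ?_⟩
  have h := hM (boolPair q.1 q.2)
  rw [id, hHval] at h
  exact h

/-- **Discharge of `PEquiv.trans`**. [cite: CookReckhow1979, §1] -/
theorem PEquiv.trans_holds : @PEquiv.trans U V W := fun hUV hVW =>
  ⟨PSimulates.trans_holds hUV.1 hVW.1, PSimulates.trans_holds hVW.2 hUV.2⟩

/-! ### Function form versus verifier form of a proof system

Cook–Reckhow 1979, Def. 1.3: "a proof system for `L` is a function `f : Σ₁* → L` … in `ℒ` such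
that `f` is onto"; proof of Prop. 1.4: "If `L ≠ ∅`, we define `f` such
that if `x` codes a computation of `M` which accepts `y`, then `f(x) = y`. If `x` does not code an
accepting computation, then `f(x) = y₀` for some fixed `y₀ ∈ L`." Krajíček, *Proof complexity*
(CUP 2019), Def. 1.5.1 (function version / relation version) and the paragraph following it:
"given a functional proof system `P`, the graph of `P` is a binary relation that is a relational
proof system. On the other hand, for a relational proof system `Q`, define a function `P` by the
following: if `w` encodes a pair `(u, v)` such that `Q(u, v)` then put `P(w) := v`; otherwise, put
`P(w) := ⊤`." Below, the fixed element `x₀ ∈ L` plays the role of `⊤` (whence `L.Nonempty`). -/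

section FunctionForm

variable {f : List Bool → List Bool}

/-- **The graph of a polynomial-time function is a polynomial-time verifier**: for `f ∈ FP`, the
verifier `V x π := [f π = x]` ("`π` is a proof of `f π`") is polynomial time — as a total string
function it is `eqPairFn ∘ (z ↦ ⟨f (boolUnpair z).2, (boolUnpair z).1⟩)`, the equality test of
`StringEquality.lean` after a fan-out of the two projections. [Cook–Reckhow 1979, Def. 1.3
("`ℒ` is closed under composition", §1); Krajíček 2019, Def. 1.5.1 and the following paragraph
("the graph of `P` is … a relational proof system")] [cite: CookReckhow1979, §1 Def. 1.3] -/
theorem isPolyTimeVerifier_graph (hf : f ∈ FP) :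
    IsPolyTimeVerifier fun x π => decide (f π = x) := by
  have hG : (eqPairFn ∘ fanoutFn (f ∘ fun z => (boolUnpair z).2) fun z => (boolUnpair z).1) ∈ FP :=
    comp_mem_FP eqPairFn_mem_FP
      (fanoutFn_mem_FP (comp_mem_FP hf boolUnpairSnd_mem_FP) boolUnpairFst_mem_FP)
  obtain ⟨p, M, hM⟩ := hG
  refine ⟨p, M, fun q => ?_⟩
  have h := hM (boolPair q.1 q.2)
  simp only [id, Function.comp_apply, fanoutFn_apply, boolUnpair_boolPair, eqPairFn_boolPair] at h
  exact h

/-- **From the function form to the verifier form**: if `f ∈ FP` has range `L`, then its graph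
`V x π := [f π = x]` is a proof system for `L` (no nonemptiness needed in this direction).
[Cook–Reckhow 1979, Def. 1.3; Krajíček 2019, Def. 1.5.1 and the following paragraph]
[cite: CookReckhow1979, §1 Def. 1.3] -/
theorem IsCookReckhowFunctionFor.isProofSystemFor (h : IsCookReckhowFunctionFor f L) :
    IsProofSystemFor (fun x π => decide (f π = x)) L := by
  obtain ⟨hf, hfL⟩ := h
  refine ⟨isPolyTimeVerifier_graph hf, fun x => ?_⟩
  -- membership in `L : Language Bool` is definitionally membership in the set `L`
  have hx : x ∈ L ↔ ∃ π, f π = x := (Set.ext_iff.1 hfL x).symm.trans Set.mem_range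
  simpa only [decide_eq_true_eq] using hx

/-- The accept bit of a polynomial-time verifier, as the total one-bit string function
`z ↦ [V (boolUnpair z).1 (boolUnpair z).2]`, is in `FP`: run the machine of `V` after the
re-pairing machine `polyTimeComputable_boolUnpair` (`PairingMachines.lean`), which also disposes of
the malformed input strings. [Arora–Barak 2009, §0.1, §1.3] [folklore] -/
theorem IsPolyTimeVerifier.acceptBit_mem_FP (hV : IsPolyTimeVerifier V) :
    (fun z => [V (boolUnpair z).1 (boolUnpair z).2]) ∈ FP := by
  obtain ⟨p, M, hM⟩ := PolyTimeComputable.comp_holds hV polyTimeComputable_boolUnpair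
  exact ⟨p, M, fun z => hM z⟩

/-- **Cook–Reckhow's function of a verifier is polynomial time**: for a polynomial-time verifier
`V` and a fixed string `x₀`, the total function `z ↦ if V x π then x else x₀` (where
`(x, π) = boolUnpair z`) is in `FP` — it is the branch `iteFn (accept bit) (first projection)
(constant x₀)` of `BranchingFn.lean`. [Cook–Reckhow 1979, proof of Prop. 1.4 ("`f(x) = y₀` for
some fixed `y₀ ∈ L`"); Krajíček 2019, paragraph after Def. 1.5.1 ("otherwise, put `P(w) := ⊤`");
Arora–Barak 2009, §1.3] [cite: CookReckhow1979, §1 Prop. 1.4 (proof)] -/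
theorem IsPolyTimeVerifier.functionForm_mem_FP (hV : IsPolyTimeVerifier V) (x₀ : List Bool) :
    (fun z => if V (boolUnpair z).1 (boolUnpair z).2 then (boolUnpair z).1 else x₀) ∈ FP := by
  have heq : (fun z => if V (boolUnpair z).1 (boolUnpair z).2 then (boolUnpair z).1 else x₀) =
      iteFn (fun z => [V (boolUnpair z).1 (boolUnpair z).2]) (fun z => (boolUnpair z).1)
        fun _ => x₀ :=
    funext fun z =>
      (iteFn_apply (c := fun z => [V (boolUnpair z).1 (boolUnpair z).2])
        (f := fun z => (boolUnpair z).1) (g := fun _ => x₀) (z := z) rfl).symm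
  rw [heq]
  exact iteFn_mem_FP hV.acceptBit_mem_FP boolUnpairFst_mem_FP (const_mem_FP x₀)

/-- The range of Cook–Reckhow's function of a proof system `V` for `L` with default value
`x₀ ∈ L` is exactly `L`: `⊆` by soundness of `V` (or `x₀ ∈ L`); `⊇` since every `x ∈ L` has a
`V`-proof `π`, and then `⟨x, π⟩ ↦ x`. [Cook–Reckhow 1979, proof of Prop. 1.4; Krajíček 2019,
paragraph after Def. 1.5.1] [cite: CookReckhow1979, §1 Prop. 1.4 (proof)] -/
theorem IsProofSystemFor.range_functionForm (h : IsProofSystemFor V L) {x₀ : List Bool}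
    (hx₀ : x₀ ∈ L) :
    Set.range (fun z => if V (boolUnpair z).1 (boolUnpair z).2 then (boolUnpair z).1 else x₀) =
      L := by
  refine Set.ext fun x => ⟨?_, fun hx => ?_⟩
  · rintro ⟨z, rfl⟩
    dsimp only
    split_ifs with hz
    · exact h.mem_of_eq_true hz
    · exact hx₀
  · obtain ⟨π, hπ⟩ := (h.mem_iff x).1 hx
    exact ⟨boolPair x π, by simp [hπ]⟩

/-- **From the verifier form to the function form** (needs some `x₀ ∈ L`): if `V` is a proof
system for `L` and `x₀ ∈ L`, then `z ↦ if V x π then x else x₀` (`(x, π) = boolUnpair z`) is a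
Cook–Reckhow function for `L` — in `FP` and onto `L`. [Cook–Reckhow 1979, Def. 1.3 and proof of
Prop. 1.4; Krajíček 2019, Def. 1.5.1 and the following paragraph]
[cite: CookReckhow1979, §1 Prop. 1.4 (proof)] -/
theorem IsProofSystemFor.isCookReckhowFunctionFor (h : IsProofSystemFor V L) {x₀ : List Bool}
    (hx₀ : x₀ ∈ L) :
    IsCookReckhowFunctionFor
      (fun z => if V (boolUnpair z).1 (boolUnpair z).2 then (boolUnpair z).1 else x₀) L :=
  ⟨h.isPolyTimeVerifier.functionForm_mem_FP x₀, h.range_functionForm hx₀⟩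

/-- **Discharge of `exists_isCookReckhowFunctionFor_iff`**: for a nonempty language `L`, `L` has a
proof system in Cook–Reckhow's original sense (an onto function `f : {0,1}* → L` in `FP`,
Def. 1.3) iff it has one in verifier form. (`→`) the graph of `f`, `V x π := [f π = x]`, is a
polynomial-time verifier, sound and complete for `range f = L`
(`IsCookReckhowFunctionFor.isProofSystemFor`); (`←`) with a fixed `x₀ ∈ L`, the function
`⟨x, π⟩ ↦ if V x π then x else x₀` is in `FP` and onto `L`
(`IsProofSystemFor.isCookReckhowFunctionFor`) — the device of the printed proof of Prop. 1.4
("`f(x) = y₀` for some fixed `y₀ ∈ L`") and of Krajíček's remark ("otherwise `P(w) := ⊤`").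
[Cook–Reckhow 1979 (J. Symbolic Logic 44, 36–50), §1, Def. 1.3 and proof of Prop. 1.4;
Krajíček, *Proof complexity* (CUP 2019), Def. 1.5.1 and the paragraph following it (p. 33)]
[cite: CookReckhow1979, §1 Def. 1.3 and Prop. 1.4 (proof)] -/
theorem exists_isCookReckhowFunctionFor_iff_holds : @exists_isCookReckhowFunctionFor_iff L := by
  intro hL
  constructor
  · rintro ⟨f, hf⟩
    exact ⟨_, hf.isProofSystemFor⟩
  · rintro ⟨V, hV⟩
    obtain ⟨x₀, hx₀⟩ := hL
    exact ⟨_, hV.isCookReckhowFunctionFor hx₀⟩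

end FunctionForm

end Literature.Computability.MetaComplexity
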